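import Mathlib
import Literature.Barriers.ValiantsHypothesis.AlgebraicNaturalProofs
import Literature.Computability.AlgebraicComplexity.ArithCircuitProofs
import Literature.Computability.AlgebraicComplexity.IMMInVPProofs
import Summits.ValiantsHypothesis.ValiantsHypothesis.Theorems.BarrierLeverPartitionMinorsHitByVPTwinFreeLift
import Summits.ValiantsHypothesis.ValiantsHypothesis.Theorems.BarrierLeverPartitionMinorsHitByVPTwinMatching
import Summits.ValiantsHypothesis.ValiantsHypothesis.Theorems.BarrierLeverPartitionMinorsHitByVPTwinAbsorption

/-!
# Route BarrierLever — item `PartitionMinorsHitByVP` (stmt-ValiantsHypothesis-19717):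
# general `2 × 2` gadget tables on one coordinate pair, and the FLIPPED twin-absorption doors

Helper file (`--supports stmt-ValiantsHypothesis-19717`; cell valiant-natproofs, rung V4, 𝒟-side,
prover seat val-np-p3 gen 3). Definition-free. Closes NO item.

`…TwinMatching.coeff_twinGadget` computes the layout matrix of `g₀ · ((1 + x_a)(1 + y_c) + μ x_a y_c)`.
Here the same is done for an ARBITRARY table `G = t₀₀ + t₁₀ x_a + t₀₁ y_c + t₁₁ x_a y_c`:
`coeff_{x^U y^W} (g₀ · G) = t_{[a ∈ U],[c ∈ W]} · coeff_{x^{U∖a} y^{W∖c}} g` (`coeff_tableGadget`), at cost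
`L ≤ L(g) + 12`, `deg ≤ deg g + 2` (`exists_sized_tableGadget`). With the table `t₀₀ = t₀₁ = t₁₁ = 1`,
`t₁₀ = 1 + μ` the twin-absorption engines of `…TwinAbsorption` (applied with the column mark «`c ∉ W`»,
resp. the row mark «`a ∉ U`» and `t₀₁ = 1 + μ`) give the FLIPPED doors: the `a`-twin pairs of the rows
are absorbed by the columns NOT containing `c` (`partitionMinor_hit_of_twinAbsorptionRows_flip`:
`tw_a(u) = #{W ∈ w : c ∉ W}`, children (row classes × (W ∋ c, contracted)), (twin tops × (W ∌ c))),
and the transpose (`…Cols_flip`). Together with `…TwinMatching` / `…TwinAbsorption` this puts the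
whole family of k = 1 «corner» contraction rules (memo VALNP3-G3-MEMO §2) in the tree, except the
literal-pair split R1, which is the two-strata case of `…StrataDoor`.

WHAT THIS IS NOT: one reduction step; nothing on which layouts reduce to few good leaves (the
content of item 19717), on crux 14610 or on VP vs VNP.
-/

set_option linter.dupNamespace false

namespace Summit.ValiantsHypothesis.ValiantsHypothesis.Theorems.BarrierLever.TwinMatching

open Finset
open Literature.Barriers.ValiantsHypothesis Literature.Computability.AlgebraicComplexity
open Summit.ValiantsHypothesis.ValiantsHypothesis.Theorems.BarrierLever.ProductStateSums
  (castAdd_ne_natAdd partitionExpo_apply_castAdd partitionExpo_apply_natAdd)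
open Summit.ValiantsHypothesis.ValiantsHypothesis.Theorems.BarrierLever.StrataDoor
  (coeff_killVars complexity_killVars_le totalDegree_killVars_le partitionExpo_erase_erase)

variable {h : ℕ}

/-! ## 1. The layout matrix of `g₀ · (t₀₀ + t₁₀ x_a + t₀₁ y_c + t₁₁ x_a y_c)` -/

/-- **General table gadget.** With `g₀` = the monomials of `g` avoiding `x_a, y_c`:
`coeff_{x^U y^W} (g₀ · (t₀₀ + t₁₀ x_a + t₀₁ y_c + t₁₁ x_a y_c)) = t_{[a∈U][c∈W]} · coeff_{x^{U∖a} y^{W∖c}} g`. -/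
theorem coeff_tableGadget (a c : Fin h) (g : MvPolynomial (Fin (h + h)) ℂ) (t₀₀ t₁₀ t₀₁ t₁₁ : ℂ)
    (U W : Finset (Fin h)) :
    MvPolynomial.coeff (∑ a' ∈ U, Finsupp.single (Fin.castAdd h a') 1 +
        ∑ c' ∈ W, Finsupp.single (Fin.natAdd h c') 1)
      ((∑ d ∈ g.support with (d (Fin.castAdd h a) = 0 ∧ d (Fin.natAdd h c) = 0),
          MvPolynomial.monomial d (MvPolynomial.coeff d g)) *
        (MvPolynomial.C t₀₀ + MvPolynomial.C t₁₀ * MvPolynomial.X (Fin.castAdd h a) +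
          MvPolynomial.C t₀₁ * MvPolynomial.X (Fin.natAdd h c) +
          MvPolynomial.C t₁₁ * (MvPolynomial.X (Fin.castAdd h a) * MvPolynomial.X (Fin.natAdd h c)))) =
      (if a ∈ U then (if c ∈ W then t₁₁ else t₁₀) else (if c ∈ W then t₀₁ else t₀₀)) *
        MvPolynomial.coeff (∑ a' ∈ U.erase a, Finsupp.single (Fin.castAdd h a') 1 +
          ∑ c' ∈ W.erase c, Finsupp.single (Fin.natAdd h c') 1) g := by
  classical
  set xa : Fin (h + h) := Fin.castAdd h a with hxa
  set yc : Fin (h + h) := Fin.natAdd h c with hyc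
  set g₀ : MvPolynomial (Fin (h + h)) ℂ := ∑ d ∈ g.support with (d xa = 0 ∧ d yc = 0),
      MvPolynomial.monomial d (MvPolynomial.coeff d g) with hg₀
  set m : Fin (h + h) →₀ ℕ := ∑ a' ∈ U, Finsupp.single (Fin.castAdd h a') 1 +
      ∑ c' ∈ W, Finsupp.single (Fin.natAdd h c') 1 with hm
  set m' : Fin (h + h) →₀ ℕ := ∑ a' ∈ U.erase a, Finsupp.single (Fin.castAdd h a') 1 +
      ∑ c' ∈ W.erase c, Finsupp.single (Fin.natAdd h c') 1 with hm'
  -- exponent facts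
  have hmyc : m yc = if c ∈ W then 1 else 0 := by rw [hm, hyc, partitionExpo_apply_natAdd]
  have hmxa : m xa = if a ∈ U then 1 else 0 := by rw [hm, hxa, partitionExpo_apply_castAdd]
  have hm1 : m yc ≤ 1 := by rw [hmyc]; split_ifs <;> omega
  have hm2 : (m.erase yc) xa ≤ 1 := by
    rw [Finsupp.erase_apply, if_neg (castAdd_ne_natAdd a c), hmxa]; split_ifs <;> omega
  have hm3 : m xa ≤ 1 := by rw [hmxa]; split_ifs <;> omega
  have herase : (m.erase yc).erase xa = m' := by
    rw [hm, hm', hxa, hyc]; exact partitionExpo_erase_erase U W a c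
  have hcoef₀ : ∀ e : Fin (h + h) →₀ ℕ, MvPolynomial.coeff e g₀ =
      if e xa = 0 ∧ e yc = 0 then MvPolynomial.coeff e g else 0 := fun e => by
    rw [hg₀, coeff_killVars]
  -- three exponent identities (erasing a zero exponent does nothing)
  have hyc0 : c ∉ W → m.erase yc = m := fun hcW => by
    apply Finsupp.erase_of_notMem_support
    rw [Finsupp.mem_support_iff, hmyc, if_neg hcW]; exact fun hh => hh rfl
  have hxa0 : a ∉ U → (m.erase yc).erase xa = m.erase yc := fun haU => by
    apply Finsupp.erase_of_notMem_support
    rw [Finsupp.mem_support_iff, Finsupp.erase_ne (castAdd_ne_natAdd a c), hmxa, if_neg haU]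
    exact fun hh => hh rfl
  have hE₀ : a ∉ U → c ∉ W → m = m' := fun haU hcW => by
    rw [← herase, hxa0 haU, hyc0 hcW]
  have hE₁ : c ∉ W → m.erase xa = m' := fun hcW => by
    rw [← herase, hyc0 hcW]
  have hE₂ : a ∉ U → m.erase yc = m' := fun haU => by
    rw [← herase, hxa0 haU]
  have hm'xa : m' xa = 0 := by
    rw [hm', hxa, partitionExpo_apply_castAdd, if_neg (Finset.notMem_erase a U)]
  have hm'yc : m' yc = 0 := by
    rw [hm', hyc, partitionExpo_apply_natAdd, if_neg (Finset.notMem_erase c W)]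
  -- (i) the constant part
  have hp₀ : MvPolynomial.coeff m g₀ = if a ∉ U ∧ c ∉ W then MvPolynomial.coeff m' g else 0 := by
    rw [hcoef₀]
    by_cases haU : a ∈ U
    · rw [hmxa, if_pos haU, if_neg (fun hh => one_ne_zero hh.1), if_neg (fun hh => hh.1 haU)]
    · by_cases hcW : c ∈ W
      · rw [hmyc, if_pos hcW, if_neg (fun hh => one_ne_zero hh.2), if_neg (fun hh => hh.2 hcW)]
      · rw [hE₀ haU hcW, hm'xa, hm'yc, if_pos ⟨rfl, rfl⟩, if_pos ⟨haU, hcW⟩]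
  -- (ii) the x_a part
  have hp₁ : MvPolynomial.coeff m (g₀ * MvPolynomial.X xa) =
      if a ∈ U ∧ c ∉ W then MvPolynomial.coeff m' g else 0 := by
    rw [MvPolynomial.coeff_mul_X']
    by_cases haU : a ∈ U
    · have hxas : xa ∈ m.support := by
        rw [Finsupp.mem_support_iff, hmxa, if_pos haU]; exact one_ne_zero
      rw [if_pos hxas, tsub_single_eq_erase m xa hm3, hcoef₀]
      by_cases hcW : c ∈ W
      · rw [Finsupp.erase_same, Finsupp.erase_ne (castAdd_ne_natAdd a c).symm, hmyc, if_pos hcW,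
          if_neg (fun hh => one_ne_zero hh.2), if_neg (fun hh => hh.2 hcW)]
      · rw [hE₁ hcW, hm'xa, hm'yc, if_pos ⟨rfl, rfl⟩, if_pos ⟨haU, hcW⟩]
    · have hxas : xa ∉ m.support := by
        rw [Finsupp.mem_support_iff, hmxa, if_neg haU]; exact fun hh => hh rfl
      rw [if_neg hxas, if_neg (fun hh => haU hh.1)]
  -- (iii) the y_c part
  have hp₂ : MvPolynomial.coeff m (g₀ * MvPolynomial.X yc) =
      if a ∉ U ∧ c ∈ W then MvPolynomial.coeff m' g else 0 := by
    rw [MvPolynomial.coeff_mul_X']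
    by_cases hcW : c ∈ W
    · have hycs : yc ∈ m.support := by
        rw [Finsupp.mem_support_iff, hmyc, if_pos hcW]; exact one_ne_zero
      rw [if_pos hycs, tsub_single_eq_erase m yc hm1, hcoef₀]
      by_cases haU : a ∈ U
      · rw [Finsupp.erase_ne (castAdd_ne_natAdd a c), Finsupp.erase_same, hmxa, if_pos haU,
          if_neg (fun hh => one_ne_zero hh.1), if_neg (fun hh => hh.1 haU)]
      · rw [hE₂ haU, hm'xa, hm'yc, if_pos ⟨rfl, rfl⟩, if_pos ⟨haU, hcW⟩]
    · have hycs : yc ∉ m.support := by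
        rw [Finsupp.mem_support_iff, hmyc, if_neg hcW]; exact fun hh => hh rfl
      rw [if_neg hycs, if_neg (fun hh => hcW hh.2)]
  -- (iv) the x_a y_c part
  have hp₃ : MvPolynomial.coeff m (g₀ * (MvPolynomial.X xa * MvPolynomial.X yc)) =
      if a ∈ U ∧ c ∈ W then MvPolynomial.coeff m' g else 0 := by
    rw [← mul_assoc, MvPolynomial.coeff_mul_X']
    by_cases hcW : c ∈ W
    · have hycs : yc ∈ m.support := by
        rw [Finsupp.mem_support_iff, hmyc, if_pos hcW]; exact one_ne_zero
      rw [if_pos hycs, tsub_single_eq_erase m yc hm1, MvPolynomial.coeff_mul_X']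
      by_cases haU : a ∈ U
      · have hxas : xa ∈ (m.erase yc).support := by
          rw [Finsupp.mem_support_iff, Finsupp.erase_apply, if_neg (castAdd_ne_natAdd a c), hmxa,
            if_pos haU]
          exact one_ne_zero
        rw [if_pos hxas, tsub_single_eq_erase _ xa hm2, herase, hcoef₀, hm'xa, hm'yc,
          if_pos ⟨rfl, rfl⟩, if_pos ⟨haU, hcW⟩]
      · have hxas : xa ∉ (m.erase yc).support := by
          rw [Finsupp.mem_support_iff, Finsupp.erase_apply, if_neg (castAdd_ne_natAdd a c), hmxa,
            if_neg haU]
          exact fun hh => hh rfl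
        rw [if_neg hxas, if_neg (fun hh => haU hh.1)]
    · have hycs : yc ∉ m.support := by
        rw [Finsupp.mem_support_iff, hmyc, if_neg hcW]; exact fun hh => hh rfl
      rw [if_neg hycs, if_neg (fun hh => hcW hh.2)]
  -- assemble
  have hexp : g₀ * (MvPolynomial.C t₀₀ + MvPolynomial.C t₁₀ * MvPolynomial.X xa +
        MvPolynomial.C t₀₁ * MvPolynomial.X yc +
        MvPolynomial.C t₁₁ * (MvPolynomial.X xa * MvPolynomial.X yc)) =
      MvPolynomial.C t₀₀ * g₀ + MvPolynomial.C t₁₀ * (g₀ * MvPolynomial.X xa) +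
        MvPolynomial.C t₀₁ * (g₀ * MvPolynomial.X yc) +
        MvPolynomial.C t₁₁ * (g₀ * (MvPolynomial.X xa * MvPolynomial.X yc)) := by ring
  rw [hexp, MvPolynomial.coeff_add, MvPolynomial.coeff_add, MvPolynomial.coeff_add,
    MvPolynomial.coeff_C_mul, MvPolynomial.coeff_C_mul, MvPolynomial.coeff_C_mul,
    MvPolynomial.coeff_C_mul, hp₀, hp₁, hp₂, hp₃]
  by_cases haU : a ∈ U <;> by_cases hcW : c ∈ W <;> simp [haU, hcW]

/-- The witness `g₀ · (t₀₀ + t₁₀ x_a + t₀₁ y_c + t₁₁ x_a y_c)`: size `≤ L(g) + 12`, degree `≤ deg g + 2`,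
layout matrix `coeff_{x^{U∖a} y^{W∖c}} g · t_{[a∈U][c∈W]}`. -/
theorem exists_sized_tableGadget {ι : Type*} [Fintype ι] [DecidableEq ι]
    (u w : ι → Finset (Fin h)) (a c : Fin h) (g : MvPolynomial (Fin (h + h)) ℂ) (t₀₀ t₁₀ t₀₁ t₁₁ : ℂ) :
    ∃ f : MvPolynomial (Fin (h + h)) ℂ, complexity f ≤ complexity g + 12 ∧
      f.totalDegree ≤ g.totalDegree + 2 ∧
      (Matrix.of fun i j : ι => MvPolynomial.coeff
        (∑ a' ∈ u i, Finsupp.single (Fin.castAdd h a') 1 +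
          ∑ c' ∈ w j, Finsupp.single (Fin.natAdd h c') 1) f) =
      Matrix.of fun i j : ι => MvPolynomial.coeff
          (∑ a' ∈ (u i).erase a, Finsupp.single (Fin.castAdd h a') 1 +
            ∑ c' ∈ (w j).erase c, Finsupp.single (Fin.natAdd h c') 1 : Fin (h + h) →₀ ℕ) g *
          (if a ∈ u i then (if c ∈ w j then t₁₁ else t₁₀) else (if c ∈ w j then t₀₁ else t₀₀)) := by
  classical
  set xa : Fin (h + h) := Fin.castAdd h a with hxa
  set yc : Fin (h + h) := Fin.natAdd h c with hyc
  set g₀ : MvPolynomial (Fin (h + h)) ℂ := ∑ d ∈ g.support with (d xa = 0 ∧ d yc = 0),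
      MvPolynomial.monomial d (MvPolynomial.coeff d g) with hg₀
  set G : MvPolynomial (Fin (h + h)) ℂ := MvPolynomial.C t₀₀ + MvPolynomial.C t₁₀ * MvPolynomial.X xa +
      MvPolynomial.C t₀₁ * MvPolynomial.X yc +
      MvPolynomial.C t₁₁ * (MvPolynomial.X xa * MvPolynomial.X yc) with hG
  refine ⟨g₀ * G, ?_, ?_, ?_⟩
  · -- size
    have hCX : ∀ (t : ℂ) (s : Fin (h + h)),
        complexity (MvPolynomial.C t * MvPolynomial.X s : MvPolynomial (Fin (h + h)) ℂ) ≤ 1 := fun t s => by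
      calc _ ≤ complexity (MvPolynomial.C t : MvPolynomial (Fin (h + h)) ℂ) +
            complexity (MvPolynomial.X s : MvPolynomial (Fin (h + h)) ℂ) + 1 := complexity_mul_le_holds _ _
        _ = 1 := by rw [complexity_C_holds, complexity_X_holds]
    have hXX : complexity (MvPolynomial.X xa * MvPolynomial.X yc : MvPolynomial (Fin (h + h)) ℂ) ≤ 1 := by
      calc _ ≤ complexity (MvPolynomial.X xa : MvPolynomial (Fin (h + h)) ℂ) +
            complexity (MvPolynomial.X yc : MvPolynomial (Fin (h + h)) ℂ) + 1 := complexity_mul_le_holds _ _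
        _ = 1 := by rw [complexity_X_holds, complexity_X_holds]
    have hCXX : complexity (MvPolynomial.C t₁₁ * (MvPolynomial.X xa * MvPolynomial.X yc) :
        MvPolynomial (Fin (h + h)) ℂ) ≤ 2 := by
      calc _ ≤ complexity (MvPolynomial.C t₁₁ : MvPolynomial (Fin (h + h)) ℂ) +
            complexity (MvPolynomial.X xa * MvPolynomial.X yc : MvPolynomial (Fin (h + h)) ℂ) + 1 :=
            complexity_mul_le_holds _ _
        _ ≤ 0 + 1 + 1 := by
            gcongr
            · exact (complexity_C_holds _).le
        _ = 2 := by norm_num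
    have hG : complexity G ≤ 11 := by
      calc complexity G ≤ complexity (MvPolynomial.C t₀₀ + MvPolynomial.C t₁₀ * MvPolynomial.X xa +
              MvPolynomial.C t₀₁ * MvPolynomial.X yc : MvPolynomial (Fin (h + h)) ℂ) +
            complexity (MvPolynomial.C t₁₁ * (MvPolynomial.X xa * MvPolynomial.X yc) :
              MvPolynomial (Fin (h + h)) ℂ) + 1 := complexity_add_le_holds _ _
        _ ≤ ((complexity (MvPolynomial.C t₀₀ + MvPolynomial.C t₁₀ * MvPolynomial.X xa :
                MvPolynomial (Fin (h + h)) ℂ) +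
              complexity (MvPolynomial.C t₀₁ * MvPolynomial.X yc : MvPolynomial (Fin (h + h)) ℂ) + 1)) +
            2 + 1 := by
            gcongr
            · exact complexity_add_le_holds _ _
        _ ≤ (((complexity (MvPolynomial.C t₀₀ : MvPolynomial (Fin (h + h)) ℂ) +
                complexity (MvPolynomial.C t₁₀ * MvPolynomial.X xa : MvPolynomial (Fin (h + h)) ℂ) + 1) +
              1 + 1)) + 2 + 1 := by
            gcongr
            · exact complexity_add_le_holds _ _
            · exact hCX t₀₁ yc
        _ ≤ (((0 + 1 + 1) + 1 + 1)) + 2 + 1 := by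
            gcongr
            · exact (complexity_C_holds _).le
            · exact hCX t₁₀ xa
        _ = 7 := by norm_num
        _ ≤ 11 := by norm_num
    calc complexity (g₀ * G) ≤ complexity g₀ + complexity G + 1 := complexity_mul_le_holds _ _
      _ ≤ complexity g + 11 + 1 := by
          gcongr
          exact complexity_killVars_le xa yc g
      _ = complexity g + 12 := by ring
  · -- degree
    have hCX : ∀ (t : ℂ) (s : Fin (h + h)),
        (MvPolynomial.C t * MvPolynomial.X s : MvPolynomial (Fin (h + h)) ℂ).totalDegree ≤ 1 := fun t s =>
      (MvPolynomial.totalDegree_mul _ _).trans (by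
        rw [MvPolynomial.totalDegree_C, MvPolynomial.totalDegree_X, zero_add])
    have hG2 : G.totalDegree ≤ 2 := by
      refine (MvPolynomial.totalDegree_add _ _).trans (max_le ?_ ?_)
      · refine (MvPolynomial.totalDegree_add _ _).trans (max_le ?_ ((hCX t₀₁ yc).trans (by norm_num)))
        refine (MvPolynomial.totalDegree_add _ _).trans (max_le ?_ ((hCX t₁₀ xa).trans (by norm_num)))
        rw [MvPolynomial.totalDegree_C]; exact Nat.zero_le _
      · refine (MvPolynomial.totalDegree_mul _ _).trans ?_
        rw [MvPolynomial.totalDegree_C, zero_add]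
        refine (MvPolynomial.totalDegree_mul _ _).trans ?_
        rw [MvPolynomial.totalDegree_X, MvPolynomial.totalDegree_X]
    calc (g₀ * G).totalDegree ≤ g₀.totalDegree + G.totalDegree := MvPolynomial.totalDegree_mul _ _
      _ ≤ g.totalDegree + 2 := add_le_add (totalDegree_killVars_le xa yc g) hG2
  · ext i j
    rw [Matrix.of_apply, Matrix.of_apply, hg₀, hG, hxa, hyc, coeff_tableGadget, mul_comm]

/-! ## 2. The flipped twin-absorption doors -/

/-- **Twin absorption, rows, flipped** (item 19717, 𝒟-side). As
`…TwinAbsorption.partitionMinor_hit_of_twinAbsorptionRows` with the roles of the columns containing /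
not containing `c` exchanged: columns `ecol : κ₁ ⊕ κ₂ ≃ ι` = (columns `∋ c`) ⊕ (columns `∌ c`); ONE
`g` certifies representatives × (columns `∋ c`, contracted) and twin tops × (columns `∌ c`). -/
theorem partitionMinor_hit_of_twinAbsorptionRows_flip {ι κ₁ κ₂ : Type*} [Fintype ι] [DecidableEq ι]
    [Fintype κ₁] [DecidableEq κ₁] [Fintype κ₂] [DecidableEq κ₂]
    (u w : ι → Finset (Fin h)) (a c : Fin h) (erow ecol : κ₁ ⊕ κ₂ ≃ ι) (c₁ : κ₂ → κ₁)
    (hr₁ : ∀ k, a ∉ u (erow (Sum.inl (c₁ k)))) (hr₂ : ∀ k, a ∈ u (erow (Sum.inr k)))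
    (hr₃ : ∀ k, (u (erow (Sum.inr k))).erase a = (u (erow (Sum.inl (c₁ k)))).erase a)
    (hc₀ : ∀ k, c ∈ w (ecol (Sum.inl k))) (hc₁ : ∀ k, c ∉ w (ecol (Sum.inr k)))
    (g : MvPolynomial (Fin (h + h)) ℂ)
    (hg₁ : (Matrix.of fun k k' : κ₁ => MvPolynomial.coeff
        (∑ a' ∈ (u (erow (Sum.inl k))).erase a, Finsupp.single (Fin.castAdd h a') 1 +
          ∑ c' ∈ (w (ecol (Sum.inl k'))).erase c, Finsupp.single (Fin.natAdd h c') 1) g).det ≠ 0)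
    (hg₂ : (Matrix.of fun k k' : κ₂ => MvPolynomial.coeff
        (∑ a' ∈ (u (erow (Sum.inr k))).erase a, Finsupp.single (Fin.castAdd h a') 1 +
          ∑ c' ∈ (w (ecol (Sum.inr k'))).erase c, Finsupp.single (Fin.natAdd h c') 1) g).det ≠ 0) :
    ∃ f : MvPolynomial (Fin (h + h)) ℂ, complexity f ≤ complexity g + 12 ∧
      f.totalDegree ≤ g.totalDegree + 2 ∧
      (Matrix.of fun i j : ι => MvPolynomial.coeff
        (∑ a' ∈ u i, Finsupp.single (Fin.castAdd h a') 1 +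
          ∑ c' ∈ w j, Finsupp.single (Fin.natAdd h c') 1) f).det ≠ 0 := by
  classical
  -- table: t₀₀ = t₀₁ = t₁₁ = 1, t₁₀ = 2, i.e. the factor (1 + [a ∈ U][c ∉ W])
  obtain ⟨f, hf₁, hf₂, hf₃⟩ := exists_sized_tableGadget u w a c g 1 2 1 1
  refine ⟨f, hf₁, hf₂, ?_⟩
  have key := det_twinAbsorbRows_ne_zero (κ₁ := κ₁) (κ₂ := κ₂)
    (fun ρ ρ' : Finset (Fin h) => MvPolynomial.coeff
      (∑ a' ∈ ρ, Finsupp.single (Fin.castAdd h a') 1 + ∑ c' ∈ ρ', Finsupp.single (Fin.natAdd h c') 1 :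
        Fin (h + h) →₀ ℕ) g)
    (fun i => (u i).erase a) (fun j => (w j).erase c) (fun i => a ∈ u i) (fun j => c ∉ w j)
    erow ecol c₁ hr₁ hr₂ hr₃ (fun k => not_not_intro (hc₀ k)) hc₁ 1 one_ne_zero hg₁ hg₂
  have hM : (Matrix.of fun i j : ι => MvPolynomial.coeff
        (∑ a' ∈ u i, Finsupp.single (Fin.castAdd h a') 1 +
          ∑ c' ∈ w j, Finsupp.single (Fin.natAdd h c') 1) f) =
      Matrix.of fun i j : ι => MvPolynomial.coeff
          (∑ a' ∈ (u i).erase a, Finsupp.single (Fin.castAdd h a') 1 +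
            ∑ c' ∈ (w j).erase c, Finsupp.single (Fin.natAdd h c') 1 : Fin (h + h) →₀ ℕ) g *
          (if a ∈ u i ∧ c ∉ w j then 1 + 1 else 1) := by
    rw [hf₃]
    ext i j
    simp only [Matrix.of_apply]
    by_cases haU : a ∈ u i <;> by_cases hcW : c ∈ w j <;> norm_num [haU, hcW]
  rw [hM]
  exact key

/-- **Twin absorption, columns, flipped** (the transpose): rows `erow : κ₁ ⊕ κ₂ ≃ ι` = (rows `∋ a`) ⊕
(rows `∌ a`); columns representatives ⊕ twin tops with bottoms `c₂`. -/
theorem partitionMinor_hit_of_twinAbsorptionCols_flip {ι κ₁ κ₂ : Type*} [Fintype ι] [DecidableEq ι]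
    [Fintype κ₁] [DecidableEq κ₁] [Fintype κ₂] [DecidableEq κ₂]
    (u w : ι → Finset (Fin h)) (a c : Fin h) (erow ecol : κ₁ ⊕ κ₂ ≃ ι) (c₂ : κ₂ → κ₁)
    (hr₀ : ∀ k, a ∈ u (erow (Sum.inl k))) (hr₁ : ∀ k, a ∉ u (erow (Sum.inr k)))
    (hc₁ : ∀ k, c ∉ w (ecol (Sum.inl (c₂ k)))) (hc₂ : ∀ k, c ∈ w (ecol (Sum.inr k)))
    (hc₃ : ∀ k, (w (ecol (Sum.inr k))).erase c = (w (ecol (Sum.inl (c₂ k)))).erase c)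
    (g : MvPolynomial (Fin (h + h)) ℂ)
    (hg₁ : (Matrix.of fun k k' : κ₁ => MvPolynomial.coeff
        (∑ a' ∈ (u (erow (Sum.inl k))).erase a, Finsupp.single (Fin.castAdd h a') 1 +
          ∑ c' ∈ (w (ecol (Sum.inl k'))).erase c, Finsupp.single (Fin.natAdd h c') 1) g).det ≠ 0)
    (hg₂ : (Matrix.of fun k k' : κ₂ => MvPolynomial.coeff
        (∑ a' ∈ (u (erow (Sum.inr k))).erase a, Finsupp.single (Fin.castAdd h a') 1 +
          ∑ c' ∈ (w (ecol (Sum.inr k'))).erase c, Finsupp.single (Fin.natAdd h c') 1) g).det ≠ 0) :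
    ∃ f : MvPolynomial (Fin (h + h)) ℂ, complexity f ≤ complexity g + 12 ∧
      f.totalDegree ≤ g.totalDegree + 2 ∧
      (Matrix.of fun i j : ι => MvPolynomial.coeff
        (∑ a' ∈ u i, Finsupp.single (Fin.castAdd h a') 1 +
          ∑ c' ∈ w j, Finsupp.single (Fin.natAdd h c') 1) f).det ≠ 0 := by
  classical
  -- table: t₀₀ = t₁₀ = t₁₁ = 1, t₀₁ = 2, i.e. the factor (1 + [a ∉ U][c ∈ W])
  obtain ⟨f, hf₁, hf₂, hf₃⟩ := exists_sized_tableGadget u w a c g 1 1 2 1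
  refine ⟨f, hf₁, hf₂, ?_⟩
  have key := det_twinAbsorbCols_ne_zero (κ₁ := κ₁) (κ₂ := κ₂)
    (fun ρ ρ' : Finset (Fin h) => MvPolynomial.coeff
      (∑ a' ∈ ρ, Finsupp.single (Fin.castAdd h a') 1 + ∑ c' ∈ ρ', Finsupp.single (Fin.natAdd h c') 1 :
        Fin (h + h) →₀ ℕ) g)
    (fun i => (u i).erase a) (fun j => (w j).erase c) (fun i => a ∉ u i) (fun j => c ∈ w j)
    erow ecol c₂ (fun k => not_not_intro (hr₀ k)) hr₁ hc₁ hc₂ hc₃ 1 one_ne_zero hg₁ hg₂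
  have hM : (Matrix.of fun i j : ι => MvPolynomial.coeff
        (∑ a' ∈ u i, Finsupp.single (Fin.castAdd h a') 1 +
          ∑ c' ∈ w j, Finsupp.single (Fin.natAdd h c') 1) f) =
      Matrix.of fun i j : ι => MvPolynomial.coeff
          (∑ a' ∈ (u i).erase a, Finsupp.single (Fin.castAdd h a') 1 +
            ∑ c' ∈ (w j).erase c, Finsupp.single (Fin.natAdd h c') 1 : Fin (h + h) →₀ ℕ) g *
          (if a ∉ u i ∧ c ∈ w j then 1 + 1 else 1) := by
    rw [hf₃]
    ext i j
    simp only [Matrix.of_apply]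
    by_cases haU : a ∈ u i <;> by_cases hcW : c ∈ w j <;> norm_num [haU, hcW]
  rw [hM]
  exact key

end Summit.ValiantsHypothesis.ValiantsHypothesis.Theorems.BarrierLever.TwinMatching
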